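import Summits.QuantumFields.YangMills.Theorems.SwapVirialDeficitBlowUpPeriodicTwoScaleLimit
import Summits.QuantumFields.YangMills.Theorems.SwapVirialDeficitBlowUpPeriodicTwoScaleDominatorLevel
import HarnessLib

/-!
# The PERIODIC massive-mode rung, brick PM-IId at LEVEL `r` (good-threshold route): the two-scale limit of `twoScaleVolumeR` and its uniformity on the annulus
# (free-hands support of ⟨stmt-QuantumFields-24196⟩ `SwapVirialDeficit.ToronSoftnessSharp`; the level-`r` twin of ✓`tendsto_twoScaleVolume` / ✓`twoScaleVolume_uniform_annulus`
# for LEAD ym-line-sfw-p2 g96's ✓`twoScaleFibreR`/`twoScaleVolumeR` (threshold `r·(u²s)²`))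

INPUT (pointwise, LEAD's side via ✓`eventually_twoScaleDeficit_le_iff_level` at a GOOD level `r` — null joint level set by ✓`countable_bad_levels`): for a.e. `ξ`, eventually along
`(𝓝[>]0 ×ˢ 𝓝[>]0) ×ˢ 𝓝 a₀`, `twoScaleDeficit L u s a ξ.1 ξ.2 ≤ r·(u²s)² ↔ ξ ∈ S₀(a₀)`.
OUTPUT: ★ `mem_twoScaleFibreR_iff_window`, ★★★ `tendsto_twoScaleVolumeR`, `twoScaleLimitR_le_dominator`, ★★★ `twoScaleVolumeR_uniform_annulus` = BOTH HALVES OF (I3′r) with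
`M a := (vol³⊗vol^{Fol})(W₀ ∩ S₀ a)`, ready for `relativeGap_fixedL_of_twoScaleLimit_level`.
HONEST LABEL: plumbing for a plan-level fixed-`L` rung of a DRAFT line; the pointwise input is LEAD g96's and NOT proved here; ⟨24196⟩/⟨24497⟩ OPEN; own crux ⟨22884⟩ OPEN
(blocked-on ⟨19935⟩); the Yang–Mills mass gap is NOT proved; no summit is proved by a line.  Width seat ym-line-sfw-p2-w3 g64 (cell ym-idea-1, free hands),
`--supports stmt-QuantumFields-24196`.  THEOREMS ONLY (0 `def`, 0 `sorry`), standard axioms.  References: [cite: Luscher1983, §2]; [cite: GonzalezarroyoAltes1988]; [folklore].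
-/

set_option autoImplicit false

noncomputable section

open MeasureTheory Quaternion Set Filter Topology
open scoped Quaternion ENNReal
open Literature.MathematicalPhysics.QuantumLattice
open Literature.MathematicalPhysics.QuantumFieldTheory hiding SU2
open Summit.QuantumFields.YangMills.Theorems.SwapTwistDeficit.ToronLog

attribute [local instance] Literature.Analysis.FluidPDE.Tao2016.quatMeasurableSpace
  Literature.Analysis.FluidPDE.Tao2016.quatBorelSpace
  Literature.MathematicalPhysics.QuantumLattice.secondCountableTopology_su2

namespace Summit.QuantumFields.YangMills.Theorems.SwapVirialDeficit.BlowUpRing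

open Summit.QuantumFields.YangMills.Theorems.FemtoTransferGap
open Summit.QuantumFields.YangMills.Theorems.FemtoTransferGap.TT
open Summit.QuantumFields.YangMills.Theorems.SwapVirialDeficit.ZeroModeSigma (ball3 dilateIm)
open Summit.QuantumFields.YangMills.Theorems.SwapVirialDeficit.ZeroModeGroup
open Summit.QuantumFields.YangMills.Theorems.SwapVirialDeficit.BlowUp (dil3P twoScale_uniform_annulus)

variable {L : ℕ} [NeZero L]

/-! ## §1 The level-`r` fibre as window ∩ deficit event -/

/-- ★ **The level-`r` fibre is the window cut by the level-`r` deficit event** (`u > 0`). [folklore] -/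
theorem mem_twoScaleFibreR_iff_window {u : ℝ} (hu : 0 < u) (r s a : ℝ) (ξ : ((ℍ × ℍ) × ℍ) × (Fol L → ℍ)) :
    ξ ∈ twoScaleFibreR L r u s a ↔
      (dil3P (u ^ 2 * s) (scaleQ3 u u⁻¹ ξ.1) ∈ ball3 ∧ ∀ i, ‖dilateIm (u ^ 2 * s) (ξ.2 i)‖ < 1) ∧
        twoScaleDeficit L u s a ξ.1 ξ.2 ≤ r * (u ^ 2 * s) ^ 2 := by
  simp only [twoScaleFibreR, periodicBlowUpSet, Set.mem_setOf_eq, periodicBlowUpPoint_twoScale hu, twoScaleDeficit, and_assoc]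

/-! ## §2 The two-scale limit of the level-`r` fibre volume -/

/-- ★★★ **THE TWO-SCALE LIMIT OF `twoScaleVolumeR`** (`r > 0`, `|a₀| ≤ 1`): if for a.e. `ξ` the level-`r` deficit event decides eventually as membership in a
measurable `S₀`, then `twoScaleVolumeR L r u s a → (vol³ ⊗ vol^{Fol})(W₀ ∩ S₀)`. [cite: Luscher1983, §2] -/
theorem tendsto_twoScaleVolumeR {r : ℝ} (hr : 0 < r) {a₀ : ℝ} (ha₀ : |a₀| ≤ 1) {S₀ : Set (((ℍ × ℍ) × ℍ) × (Fol L → ℍ))} (hS₀ : MeasurableSet S₀)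
    (hpt : ∀ᵐ ξ : ((ℍ × ℍ) × ℍ) × (Fol L → ℍ) ∂((volume : Measure ((ℍ × ℍ) × ℍ)).prod (Measure.pi fun _ : Fol L => (volume : Measure ℍ))),
      ∀ᶠ q : (ℝ × ℝ) × ℝ in (𝓝[>] (0 : ℝ) ×ˢ 𝓝[>] (0 : ℝ)) ×ˢ 𝓝 a₀,
        (twoScaleDeficit L q.1.1 q.1.2 q.2 ξ.1 ξ.2 ≤ r * (q.1.1 ^ 2 * q.1.2) ^ 2 ↔ ξ ∈ S₀)) :
    Tendsto (fun q : (ℝ × ℝ) × ℝ => twoScaleVolumeR L r q.1.1 q.1.2 q.2) ((𝓝[>] (0 : ℝ) ×ˢ 𝓝[>] (0 : ℝ)) ×ˢ 𝓝 a₀)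
      (𝓝 (((volume : Measure ((ℍ × ℍ) × ℍ)).prod (Measure.pi fun _ : Fol L => (volume : Measure ℍ)))
        ({ξ | ((|ξ.1.1.1.re| < 1 ∧ |ξ.1.1.2.re| < 1) ∧ |ξ.1.2.re| < 1) ∧ ∀ i, |(ξ.2 i).re| < 1} ∩ S₀))) := by
  have hW : MeasurableSet {ξ : ((ℍ × ℍ) × ℍ) × (Fol L → ℍ) | ((|ξ.1.1.1.re| < 1 ∧ |ξ.1.1.2.re| < 1) ∧ |ξ.1.2.re| < 1) ∧ ∀ i, |(ξ.2 i).re| < 1} := by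
    have hre : Measurable fun v : ℍ => |v.re| := Quaternion.continuous_re.measurable.abs
    refine ((((measurableSet_lt (hre.comp (measurable_fst.comp (measurable_fst.comp measurable_fst))) measurable_const).inter
      (measurableSet_lt (hre.comp (measurable_snd.comp (measurable_fst.comp measurable_fst))) measurable_const)).inter
      (measurableSet_lt (hre.comp (measurable_snd.comp measurable_fst)) measurable_const)).inter ?_)
    show MeasurableSet {ξ : ((ℍ × ℍ) × ℍ) × (Fol L → ℍ) | ∀ i, |(ξ.2 i).re| < 1}
    rw [Set.setOf_forall]
    exact MeasurableSet.iInter fun i => measurableSet_lt (hre.comp ((measurable_pi_apply i).comp measurable_snd)) measurable_const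
  unfold twoScaleVolumeR
  refine tendsto_measure_of_ae_tendsto_indicator ((𝓝[>] (0 : ℝ) ×ˢ 𝓝[>] (0 : ℝ)) ×ˢ 𝓝 a₀) (hW.inter hS₀)
    (fun q => measurableSet_twoScaleFibreR r q.1.1 q.1.2 q.2) (measurableSet_twoScaleDominatorR r) (volume_twoScaleDominatorR_lt_top hr).ne
    (eventually_twoScaleFibreR_subset hr ha₀) ?_
  have hu : ∀ᶠ q : (ℝ × ℝ) × ℝ in (𝓝[>] (0 : ℝ) ×ˢ 𝓝[>] (0 : ℝ)) ×ˢ 𝓝 a₀, 0 < q.1.1 :=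
    (tendsto_fst.comp tendsto_fst).eventually self_mem_nhdsWithin
  filter_upwards [ae_eventually_mem_twoScaleWindow_iff (L := L) a₀, hpt] with ξ hwin hdef
  filter_upwards [hu, hwin, hdef] with q hq hw hd
  rw [mem_twoScaleFibreR_iff_window hq, Set.mem_inter_iff, Set.mem_setOf_eq, hw, hd]

/-- The level-`r` two-scale limit is dominated. [folklore] -/
theorem twoScaleLimitR_le_dominator {r : ℝ} (hr : 0 < r) {a₀ : ℝ} (ha₀ : |a₀| ≤ 1) {S₀ : Set (((ℍ × ℍ) × ℍ) × (Fol L → ℍ))} (hS₀ : MeasurableSet S₀)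
    (hpt : ∀ᵐ ξ : ((ℍ × ℍ) × ℍ) × (Fol L → ℍ) ∂((volume : Measure ((ℍ × ℍ) × ℍ)).prod (Measure.pi fun _ : Fol L => (volume : Measure ℍ))),
      ∀ᶠ q : (ℝ × ℝ) × ℝ in (𝓝[>] (0 : ℝ) ×ˢ 𝓝[>] (0 : ℝ)) ×ˢ 𝓝 a₀,
        (twoScaleDeficit L q.1.1 q.1.2 q.2 ξ.1 ξ.2 ≤ r * (q.1.1 ^ 2 * q.1.2) ^ 2 ↔ ξ ∈ S₀)) :
    ((volume : Measure ((ℍ × ℍ) × ℍ)).prod (Measure.pi fun _ : Fol L => (volume : Measure ℍ)))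
        ({ξ | ((|ξ.1.1.1.re| < 1 ∧ |ξ.1.1.2.re| < 1) ∧ |ξ.1.2.re| < 1) ∧ ∀ i, |(ξ.2 i).re| < 1} ∩ S₀) ≤
      ((volume : Measure ((ℍ × ℍ) × ℍ)).prod (Measure.pi fun _ : Fol L => (volume : Measure ℍ)))
        ((((scaleQ3 1 (20 * (L : ℝ) ^ 2 * Real.sqrt r)⁻¹ ⁻¹' domSet4) ∪ {w : (ℍ × ℍ) × ℍ | w.1.1 = 0 ∨ w.1.2 = 0 ∨ w.2 = 0}) ×ˢ
          ((Set.univ.pi fun _ : Fol L => {y : ℍ | |y.re| < 1 ∧ ‖y.im‖ ≤ 12 * (L : ℝ) ^ 2 * Real.sqrt r}) ∪ {y : Fol L → ℍ | ∃ i, y i = 0}))) := by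
  have ht := tendsto_twoScaleVolumeR hr ha₀ hS₀ hpt
  haveI : ((𝓝[>] (0 : ℝ) ×ˢ 𝓝[>] (0 : ℝ)) ×ˢ 𝓝 a₀).NeBot := Filter.prod_neBot.2 ⟨Filter.prod_neBot.2 ⟨inferInstance, inferInstance⟩, inferInstance⟩
  refine le_of_tendsto ht ?_
  filter_upwards [eventually_twoScaleFibreR_subset (L := L) hr ha₀] with q hq
  exact measure_mono hq

/-! ## §3 Uniformity on the annulus = both halves of (I3′r) -/

/-- ★★★ **(I3′r) FROM THE POINTWISE INPUT** (`r > 0`), `M a := (vol³ ⊗ vol^{Fol})(W₀ ∩ S₀ a)`. [cite: Luscher1983, §2] -/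
theorem twoScaleVolumeR_uniform_annulus {r : ℝ} (hr : 0 < r) {r₀ : ℝ} {S₀ : ℝ → Set (((ℍ × ℍ) × ℍ) × (Fol L → ℍ))} (hS₀ : ∀ a, MeasurableSet (S₀ a))
    (hpt : ∀ a₀ : ℝ, r₀ ≤ |a₀| → |a₀| ≤ 1 →
      ∀ᵐ ξ : ((ℍ × ℍ) × ℍ) × (Fol L → ℍ) ∂((volume : Measure ((ℍ × ℍ) × ℍ)).prod (Measure.pi fun _ : Fol L => (volume : Measure ℍ))),
        ∀ᶠ q : (ℝ × ℝ) × ℝ in (𝓝[>] (0 : ℝ) ×ˢ 𝓝[>] (0 : ℝ)) ×ˢ 𝓝 a₀,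
          (twoScaleDeficit L q.1.1 q.1.2 q.2 ξ.1 ξ.2 ≤ r * (q.1.1 ^ 2 * q.1.2) ^ 2 ↔ ξ ∈ S₀ a₀))
    {ε' : ℝ} (hε' : 0 < ε') :
    ∃ θ > (0 : ℝ), ∀ a₀ : ℝ, r₀ ≤ |a₀| → |a₀| ≤ 1 → ∀ u ∈ Ioo (0 : ℝ) θ, ∀ s ∈ Ioo (0 : ℝ) θ,
      twoScaleVolumeR L r u s a₀ ≤
          ((volume : Measure ((ℍ × ℍ) × ℍ)).prod (Measure.pi fun _ : Fol L => (volume : Measure ℍ)))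
            ({ξ | ((|ξ.1.1.1.re| < 1 ∧ |ξ.1.1.2.re| < 1) ∧ |ξ.1.2.re| < 1) ∧ ∀ i, |(ξ.2 i).re| < 1} ∩ S₀ a₀) + ENNReal.ofReal ε' ∧
        ((volume : Measure ((ℍ × ℍ) × ℍ)).prod (Measure.pi fun _ : Fol L => (volume : Measure ℍ)))
            ({ξ | ((|ξ.1.1.1.re| < 1 ∧ |ξ.1.1.2.re| < 1) ∧ |ξ.1.2.re| < 1) ∧ ∀ i, |(ξ.2 i).re| < 1} ∩ S₀ a₀) ≤
          twoScaleVolumeR L r u s a₀ + ENNReal.ofReal ε' := by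
  refine twoScale_uniform_annulus (W := twoScaleVolumeR L r)
    (M := fun a => ((volume : Measure ((ℍ × ℍ) × ℍ)).prod (Measure.pi fun _ : Fol L => (volume : Measure ℍ)))
      ({ξ | ((|ξ.1.1.1.re| < 1 ∧ |ξ.1.1.2.re| < 1) ∧ |ξ.1.2.re| < 1) ∧ ∀ i, |(ξ.2 i).re| < 1} ∩ S₀ a))
    (fun a₀ h1 h2 => ?_) (fun a₀ h1 h2 => tendsto_twoScaleVolumeR hr h2 (hS₀ a₀) (hpt a₀ h1 h2)) hε'
  exact ne_top_of_le_ne_top (volume_twoScaleDominatorR_lt_top hr).ne (twoScaleLimitR_le_dominator hr h2 (hS₀ a₀) (hpt a₀ h1 h2))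


/-! ## §4 The a.e.-in-`a₀` socket (I3‴r) (LEAD g96's architecture note 14:32Z: only a.e. hubs are good at a fixed level) -/

/-- Restriction of a two-scale limit with moving hub to the FIXED hub `a₀`: `(𝓝[>]0 ×ˢ 𝓝[>]0) ×ˢ pure a₀ ≤ (𝓝[>]0 ×ˢ 𝓝[>]0) ×ˢ 𝓝 a₀`. [folklore] -/
theorem tendsto_fixedHub_of_movingHub {W : ℝ → ℝ → ℝ → ℝ≥0∞} {a₀ : ℝ} {m : ℝ≥0∞}
    (h : Tendsto (fun q : (ℝ × ℝ) × ℝ => W q.1.1 q.1.2 q.2) ((𝓝[>] (0 : ℝ) ×ˢ 𝓝[>] (0 : ℝ)) ×ˢ 𝓝 a₀) (𝓝 m)) :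
    Tendsto (fun p : ℝ × ℝ => W p.1 p.2 a₀) (𝓝[>] (0 : ℝ) ×ˢ 𝓝[>] (0 : ℝ)) (𝓝 m) :=
  h.comp (tendsto_id.prodMk tendsto_const_nhds)

/-- ★★ **(I3‴r) AT ONE GOOD HUB**: the fixed-hub two-scale limit `twoScaleVolumeR L r u s a₀ → (vol³⊗vol^{Fol})(W₀ ∩ S₀)` as `(u,s) → (0⁺,0⁺)`, from the pointwise input at `a₀`.
[cite: Luscher1983, §2] -/
theorem tendsto_twoScaleVolumeR_fixedHub {r : ℝ} (hr : 0 < r) {a₀ : ℝ} (ha₀ : |a₀| ≤ 1) {S₀ : Set (((ℍ × ℍ) × ℍ) × (Fol L → ℍ))} (hS₀ : MeasurableSet S₀)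
    (hpt : ∀ᵐ ξ : ((ℍ × ℍ) × ℍ) × (Fol L → ℍ) ∂((volume : Measure ((ℍ × ℍ) × ℍ)).prod (Measure.pi fun _ : Fol L => (volume : Measure ℍ))),
      ∀ᶠ q : (ℝ × ℝ) × ℝ in (𝓝[>] (0 : ℝ) ×ˢ 𝓝[>] (0 : ℝ)) ×ˢ 𝓝 a₀,
        (twoScaleDeficit L q.1.1 q.1.2 q.2 ξ.1 ξ.2 ≤ r * (q.1.1 ^ 2 * q.1.2) ^ 2 ↔ ξ ∈ S₀)) :
    Tendsto (fun p : ℝ × ℝ => twoScaleVolumeR L r p.1 p.2 a₀) (𝓝[>] (0 : ℝ) ×ˢ 𝓝[>] (0 : ℝ))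
      (𝓝 (((volume : Measure ((ℍ × ℍ) × ℍ)).prod (Measure.pi fun _ : Fol L => (volume : Measure ℍ)))
        ({ξ | ((|ξ.1.1.1.re| < 1 ∧ |ξ.1.1.2.re| < 1) ∧ |ξ.1.2.re| < 1) ∧ ∀ i, |(ξ.2 i).re| < 1} ∩ S₀))) :=
  tendsto_fixedHub_of_movingHub (W := twoScaleVolumeR L r) (tendsto_twoScaleVolumeR hr ha₀ hS₀ hpt)

/-- ★★ **(I3‴r) FOR A.E. HUB** from an a.e.-in-`a₀` pointwise input (e.g. at a product-good level `r`, via `Measure.ae_ae_of_ae_prod`). [cite: Luscher1983, §2] -/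
theorem ae_tendsto_twoScaleVolumeR {r : ℝ} (hr : 0 < r) {S₀ : ℝ → Set (((ℍ × ℍ) × ℍ) × (Fol L → ℍ))} (hS₀ : ∀ a, MeasurableSet (S₀ a)) {ν : Measure ℝ}
    (hpt : ∀ᵐ a₀ ∂ν, |a₀| ≤ 1 →
      ∀ᵐ ξ : ((ℍ × ℍ) × ℍ) × (Fol L → ℍ) ∂((volume : Measure ((ℍ × ℍ) × ℍ)).prod (Measure.pi fun _ : Fol L => (volume : Measure ℍ))),
        ∀ᶠ q : (ℝ × ℝ) × ℝ in (𝓝[>] (0 : ℝ) ×ˢ 𝓝[>] (0 : ℝ)) ×ˢ 𝓝 a₀,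
          (twoScaleDeficit L q.1.1 q.1.2 q.2 ξ.1 ξ.2 ≤ r * (q.1.1 ^ 2 * q.1.2) ^ 2 ↔ ξ ∈ S₀ a₀)) :
    ∀ᵐ a₀ ∂ν, |a₀| ≤ 1 → Tendsto (fun p : ℝ × ℝ => twoScaleVolumeR L r p.1 p.2 a₀) (𝓝[>] (0 : ℝ) ×ˢ 𝓝[>] (0 : ℝ))
      (𝓝 (((volume : Measure ((ℍ × ℍ) × ℍ)).prod (Measure.pi fun _ : Fol L => (volume : Measure ℍ)))
        ({ξ | ((|ξ.1.1.1.re| < 1 ∧ |ξ.1.1.2.re| < 1) ∧ |ξ.1.2.re| < 1) ∧ ∀ i, |(ξ.2 i).re| < 1} ∩ S₀ a₀))) := by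
  filter_upwards [hpt] with a₀ h ha₀ using tendsto_twoScaleVolumeR_fixedHub hr ha₀ (hS₀ a₀) (h ha₀)

end Summit.QuantumFields.YangMills.Theorems.SwapVirialDeficit.BlowUpRing

end
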